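import Summits.QuantumFields.YangMills.Theorems.SmallCircleAnchorAnchorGapGaussianIntegralSmooth

/-!
# Crux `AnchorGap` (stmt-QuantumFields-11141), line `registered` — Gaussian integrals and normalised
# expectations are smooth in the COVARIANCE (step (G1) of the assembly of GREP, part: inverse ∘ SMOOTH)

Continuation of `SmallCircleAnchorAnchorGapGaussianIntegralSmooth.lean` (✓ stub SMOOTH): the map
`E Cv H = ∫ H e^{−½φᵀCv⁻¹φ} ∕ ∫ e^{−½φᵀCv⁻¹φ}` of GREP (`stub_gaussianBBFPolymerRep`) is `C^∞` in the
covariance `Cv` on the positive definite cone, and the positive definite locus of any continuous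
SYMMETRIC matrix family (such as GREP's pair interpolation `σ ↦ cov X σ`) is open — the two generic
facts behind the smoothness hypothesis of the peeling formula (LOCATE-GREP (G1), evidence on
stmt-QuantumFields-11141).  [folklore]; no definition, no named fact.

* §5 `contDiff_matrix_det`, `contDiff_updateRow`, `contDiff_adjugate_apply` (polynomials in the entries),
  `contDiffOn_matrix_inv` (Cramer: `A⁻¹ = (det A)⁻¹ • adj A` on `det ≠ 0`), `contDiffOn_gaussInt_cov`
  (SMOOTH ∘ inverse, `Matrix.PosDef.inv`), `gaussInt_partition_pos`, `contDiffOn_gaussExpect_cov`;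
* §6 `posDef_of_isSymm_of_coercive`, `isOpen_posDef_preimage`.
-/

set_option autoImplicit false

noncomputable section

namespace Summit.QuantumFields.YangMills.Theorems.AnchorGap

namespace GaussSmooth

open MeasureTheory Finset Matrix Filter Metric
open scoped Topology

variable {ι : Type} [Fintype ι] [DecidableEq ι]

/-! ### §5 Smoothness in the COVARIANCE: determinant, adjugate, inverse -/

/-- The determinant is a smooth function of the entries (a polynomial). [folklore] -/
theorem contDiff_matrix_det : ContDiff ℝ (⊤ : ℕ∞) (fun A : ι → ι → ℝ => (Matrix.of A).det) := by
  have h : (fun A : ι → ι → ℝ => (Matrix.of A).det)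
      = fun A => ∑ σ : Equiv.Perm ι, ((Equiv.Perm.sign σ : ℤ) : ℝ) * ∏ i, A (σ i) i := by
    funext A
    rw [Matrix.det_apply]
    refine Finset.sum_congr rfl fun σ _ => ?_
    rw [Units.smul_def, zsmul_eq_mul]
    rfl
  rw [h]
  refine ContDiff.sum fun σ _ => contDiff_const.mul ?_
  exact contDiff_prod fun i _ => contDiff_apply_apply ℝ ℝ (σ i) i

/-- Replacing a row by a constant row is a smooth (affine) map of the entries. [folklore] -/
theorem contDiff_updateRow (j : ι) (c : ι → ℝ) :
    ContDiff ℝ (⊤ : ℕ∞) (fun A : ι → ι → ℝ => Function.update A j c) := by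
  refine contDiff_pi.2 fun k => ?_
  by_cases hk : k = j
  · subst hk
    have : (fun A : ι → ι → ℝ => Function.update A k c k) = fun _ => c := by
      funext A; exact Function.update_self ..
    rw [this]; exact contDiff_const
  · have : (fun A : ι → ι → ℝ => Function.update A j c k) = fun A => A k := by
      funext A; exact Function.update_of_ne hk ..
    rw [this]; exact contDiff_apply ℝ (ι → ℝ) k

/-- The entries of the adjugate are smooth functions of the entries (determinants of row
replacements, `Matrix.adjugate_apply`). [folklore] -/
theorem contDiff_adjugate_apply (i j : ι) :
    ContDiff ℝ (⊤ : ℕ∞) (fun A : ι → ι → ℝ => (Matrix.of A).adjugate i j) := by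
  have h : (fun A : ι → ι → ℝ => (Matrix.of A).adjugate i j)
      = fun A => (Matrix.of (Function.update A j (Pi.single i 1))).det := by
    funext A; rw [Matrix.adjugate_apply]; rfl
  rw [h]
  exact contDiff_matrix_det.comp (contDiff_updateRow j _)

/-- **Matrix inversion is smooth on the invertible matrices** (Cramer: `A⁻¹ = (det A)⁻¹ • adj A`).
[folklore] -/
theorem contDiffOn_matrix_inv :
    ContDiffOn ℝ (⊤ : ℕ∞) (fun A : ι → ι → ℝ => fun i j => (Matrix.of A)⁻¹ i j)
      {A : ι → ι → ℝ | (Matrix.of A).det ≠ 0} := by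
  refine contDiffOn_pi.2 fun i => contDiffOn_pi.2 fun j => ?_
  have h : ∀ A ∈ {A : ι → ι → ℝ | (Matrix.of A).det ≠ 0},
      (Matrix.of A)⁻¹ i j = ((Matrix.of A).det)⁻¹ * (Matrix.of A).adjugate i j := by
    intro A hA
    rw [Matrix.inv_def, Ring.inverse_eq_inv', Matrix.smul_apply, smul_eq_mul]
  refine ContDiffOn.congr ?_ h
  exact ((contDiff_matrix_det.contDiffOn).inv fun A hA => hA).mul (contDiff_adjugate_apply i j).contDiffOn

/-- **Gaussian integrals are smooth in the COVARIANCE** on the positive definite cone: composition of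
`stub_gaussianIntegralSmooth` (smooth in the precision) with matrix inversion. [folklore] -/
theorem contDiffOn_gaussInt_cov (H : (ι → ℝ) → ℝ) (K : ℝ) (m : ℕ) (hHm : Measurable H)
    (hHb : ∀ φ : ι → ℝ, |H φ| ≤ K * (1 + ∑ i, φ i ^ 2) ^ m) :
    ContDiffOn ℝ (⊤ : ℕ∞)
      (fun Cv : ι → ι → ℝ => ∫ φ : ι → ℝ, H φ * Real.exp (-(φ ⬝ᵥ ((Matrix.of Cv)⁻¹ *ᵥ φ)) / 2))
      {Cv : ι → ι → ℝ | (Matrix.of Cv).PosDef} := by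
  have hS := stub_gaussianIntegralSmooth ι H K m hHm hHb
  have hmaps : Set.MapsTo (fun A : ι → ι → ℝ => fun i j => (Matrix.of A)⁻¹ i j)
      {Cv : ι → ι → ℝ | (Matrix.of Cv).PosDef} {P : ι → ι → ℝ | (Matrix.of P).PosDef} := by
    intro Cv hCv
    exact hCv.inv
  have hsub : {Cv : ι → ι → ℝ | (Matrix.of Cv).PosDef} ⊆ {A : ι → ι → ℝ | (Matrix.of A).det ≠ 0} :=
    fun Cv hCv => hCv.det_pos.ne'
  exact hS.comp (contDiffOn_matrix_inv.mono hsub) hmaps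

/-- The Gaussian partition function is positive. [folklore] -/
theorem gaussInt_partition_pos {Cv : ι → ι → ℝ} (hCv : (Matrix.of Cv).PosDef) :
    0 < ∫ φ : ι → ℝ, Real.exp (-(φ ⬝ᵥ ((Matrix.of Cv)⁻¹ *ᵥ φ)) / 2) := by
  have hint : Integrable (fun φ : ι → ℝ => (1 : ℝ) * Real.exp (-(φ ⬝ᵥ ((Matrix.of Cv)⁻¹ *ᵥ φ)) / 2)) :=
    integrable_polyGrowth_mul_gaussian ι (Matrix.of Cv)⁻¹ hCv.inv 0 1 (fun _ => 1)
      measurable_const.aestronglyMeasurable (fun φ => by simp)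
  simp only [one_mul] at hint
  exact integral_exp_pos hint

/-- **Normalised Gaussian expectations are smooth in the covariance** on the positive definite
cone (quotient of two smooth integrals, the partition function being positive): the function
`E Cv H = ∫ H e^{−½φᵀCv⁻¹φ} ∕ ∫ e^{−½φᵀCv⁻¹φ}` of GREP. [folklore] -/
theorem contDiffOn_gaussExpect_cov (H : (ι → ℝ) → ℝ) (K : ℝ) (m : ℕ) (hHm : Measurable H)
    (hHb : ∀ φ : ι → ℝ, |H φ| ≤ K * (1 + ∑ i, φ i ^ 2) ^ m) :
    ContDiffOn ℝ (⊤ : ℕ∞)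
      (fun Cv : ι → ι → ℝ => (∫ φ : ι → ℝ, H φ * Real.exp (-(φ ⬝ᵥ ((Matrix.of Cv)⁻¹ *ᵥ φ)) / 2))
        / ∫ φ : ι → ℝ, Real.exp (-(φ ⬝ᵥ ((Matrix.of Cv)⁻¹ *ᵥ φ)) / 2))
      {Cv : ι → ι → ℝ | (Matrix.of Cv).PosDef} := by
  have h1 := contDiffOn_gaussInt_cov H K m hHm hHb
  have h2 := contDiffOn_gaussInt_cov (ι := ι) (fun _ => (1 : ℝ)) 1 0 measurable_const (fun φ => by simp)
  simp only [one_mul] at h2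
  exact h1.div h2 fun Cv hCv => (gaussInt_partition_pos hCv).ne'

/-! ### §6 Where a symmetric matrix family is positive definite is open -/

omit [DecidableEq ι] in
/-- A symmetric coercive matrix is positive definite. [folklore] -/
theorem posDef_of_isSymm_of_coercive {M : Matrix ι ι ℝ} (hM : M.IsSymm) {c : ℝ} (hc : 0 < c)
    (hcoer : ∀ φ : ι → ℝ, c * ∑ i, φ i ^ 2 ≤ φ ⬝ᵥ (M *ᵥ φ)) : M.PosDef := by
  refine Matrix.PosDef.of_dotProduct_mulVec_pos (Matrix.isHermitian_iff_isSymm.2 hM) fun φ hφ => ?_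
  simp only [star_trivial]
  obtain ⟨i, hi⟩ : ∃ i, φ i ≠ 0 := Function.ne_iff.1 hφ
  have hpos : 0 < ∑ j, φ j ^ 2 := lt_of_lt_of_le (by positivity : 0 < φ i ^ 2)
    (Finset.single_le_sum (f := fun j => φ j ^ 2) (fun j _ => sq_nonneg _) (Finset.mem_univ i))
  exact lt_of_lt_of_le (mul_pos hc hpos) (hcoer φ)

omit [DecidableEq ι] in
/-- **The positive definite locus of a continuous SYMMETRIC matrix family is open** (although the
positive definite cone itself is not open among all matrices): it is the preimage of the open set
of coercive matrices (`isOpen_coercive`, `posDef_coercive`). [folklore] -/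
theorem isOpen_posDef_preimage {E : Type} [TopologicalSpace E] {f : E → (ι → ι → ℝ)}
    (hf : Continuous f) (hsymm : ∀ x, (Matrix.of (f x)).IsSymm) :
    IsOpen {x : E | (Matrix.of (f x)).PosDef} := by
  have heq : {x : E | (Matrix.of (f x)).PosDef}
      = f ⁻¹' {P : ι → ι → ℝ | ∃ c : ℝ, 0 < c ∧ ∀ φ : ι → ℝ, c * ∑ i, φ i ^ 2 ≤ φ ⬝ᵥ (Matrix.of P *ᵥ φ)} := by
    ext x
    simp only [Set.mem_setOf_eq, Set.mem_preimage]
    constructor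
    · intro h; exact posDef_coercive ι _ h
    · rintro ⟨c, hc, hcoer⟩; exact posDef_of_isSymm_of_coercive (hsymm x) hc hcoer
  rw [heq]
  exact isOpen_coercive.preimage hf

end GaussSmooth

end Summit.QuantumFields.YangMills.Theorems.AnchorGap
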